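import Summits.AtomisticToContinuum.Crystallization.Theorems.ChargedEnergyGap.Negative.Unconditional

/-!
# Stub `stub_mergeReduction` of line `merge-perron`, crux `PerronTransitivity.NoFractionalGain`
(stmt-AtomisticToContinuum-15098, route `PerronTransitivity`)

THE WEIGHTED NO-SPLITTING (MERGE) REDUCTION.  Write `E* := ⨅_Q e_LJ(Q)` (an opaque real constant
here) and, for a finite weighted configuration `(x, c)` of `ℝ³`,
`F(x, c) := ∑_i ∑_{j ≠ i} cᵢ cⱼ V_LJ(|xᵢ − xⱼ|) − 2E*·∑_i cᵢ²`.
If the core of the pair potential is at least `−2E*` high on `(0, δ]`, then every weighted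
configuration with `c ≥ 0` can be replaced by a `δ`-SEPARATED one with `F` no larger.

Proof.  MERGE STEP (pure finite algebra, for a symmetric kernel `V` on a finite index type): for
`i ≠ j` with `−2E* ≤ V i j`, external fields `Lᵢ := ∑_{k ∉ {i,j}} c_k V i k ≤ Lⱼ := ∑_{k ∉ {i,j}} c_k V j k`
and merged weights `c'ᵢ := cᵢ + cⱼ`, `c'ⱼ := 0`, `c'_k := c_k` otherwise,
`F(c) − F(c') = 2cᵢcⱼ(V i j + 2E*) + 2cⱼ(Lⱼ − Lᵢ) ≥ 0` (two-index decomposition of the quadratic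
form).  PHASE A: induction on the size of the support of `c` — each merge of a close pair of support
points kills one support point — yields weights on the same index set with `δ`-separated support and
no larger `F`.  PHASE B: re-index the support increasingly (`Finset.orderEmbOfFin`); all sums agree
since the dropped indices carry weight `0`.  Nothing about `⨅` or `V_LJ` is used beyond the displayed
core hypothesis (fed with `0 < dist` from injectivity).
-/

noncomputable section

namespace Summit.AtomisticToContinuum.Crystallization.Theorems.PerronTransitivity.NoFractionalGain

open Literature.MathematicalPhysics.StatisticalMechanics
open scoped BigOperators

section MergeAlgebra

variable {ι : Type*} [Fintype ι] [DecidableEq ι]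

/-- Splitting a sum over all indices at two distinct indices `i ≠ j`. [folklore] -/
private theorem mergeRed_sum_univ_split {i j : ι} (hij : i ≠ j) (f : ι → ℝ) :
    ∑ k, f k = f i + f j + ∑ k ∈ (Finset.univ.erase i).erase j, f k := by
  rw [← Finset.add_sum_erase _ _ (Finset.mem_univ i),
    ← Finset.add_sum_erase _ _ (Finset.mem_erase.2 ⟨hij.symm, Finset.mem_univ j⟩), add_assoc]

/-- Splitting a sum over `univ.erase i` at `j ≠ i`. [folklore] -/
private theorem mergeRed_sum_erase_left {i j : ι} (hij : i ≠ j) (f : ι → ℝ) :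
    ∑ k ∈ Finset.univ.erase i, f k = f j + ∑ k ∈ (Finset.univ.erase i).erase j, f k :=
  (Finset.add_sum_erase _ _ (Finset.mem_erase.2 ⟨hij.symm, Finset.mem_univ j⟩)).symm

/-- Splitting a sum over `univ.erase j` at `i ≠ j`. [folklore] -/
private theorem mergeRed_sum_erase_right {i j : ι} (hij : i ≠ j) (f : ι → ℝ) :
    ∑ k ∈ Finset.univ.erase j, f k = f i + ∑ k ∈ (Finset.univ.erase i).erase j, f k := by
  rw [Finset.erase_right_comm (a := i) (b := j)]
  exact (Finset.add_sum_erase _ _ (Finset.mem_erase.2 ⟨hij, Finset.mem_univ i⟩)).symm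

/-- Splitting a sum over `univ.erase k` at `i` and `j`, for `k ∉ {i, j}`. [folklore] -/
private theorem mergeRed_sum_erase_of_mem_rest {i j k : ι} (hij : i ≠ j)
    (hk : k ∈ (Finset.univ.erase i).erase j) (f : ι → ℝ) :
    ∑ l ∈ Finset.univ.erase k, f l =
      f i + f j + ∑ l ∈ ((Finset.univ.erase i).erase j).erase k, f l := by
  simp only [Finset.mem_erase, Finset.mem_univ, and_true] at hk
  have hi : i ∈ Finset.univ.erase k := Finset.mem_erase.2 ⟨fun h => hk.2 h.symm, Finset.mem_univ i⟩
  have hj : j ∈ (Finset.univ.erase k).erase i :=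
    Finset.mem_erase.2 ⟨hij.symm, Finset.mem_erase.2 ⟨fun h => hk.1 h.symm, Finset.mem_univ j⟩⟩
  rw [← Finset.add_sum_erase _ _ hi, ← Finset.add_sum_erase _ _ hj, add_assoc]
  have hset : ((Finset.univ.erase k).erase i).erase j = ((Finset.univ.erase i).erase j).erase k := by
    ext l
    simp only [Finset.mem_erase, Finset.mem_univ, and_true]
    tauto
  rw [hset]

/-- Two-index decomposition of the off-diagonal quadratic form `∑_k ∑_{l ≠ k} c_k c_l V k l` of a
symmetric kernel at `i ≠ j`: pair term, the two external fields, and the form of the rest.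
[folklore] -/
private theorem mergeRed_quad_decomp (V : ι → ι → ℝ) (hV : ∀ k l, V k l = V l k) (c : ι → ℝ)
    {i j : ι} (hij : i ≠ j) :
    ∑ k, ∑ l ∈ Finset.univ.erase k, c k * c l * V k l =
      2 * (c i * c j * V i j) +
        2 * (c i * ∑ k ∈ (Finset.univ.erase i).erase j, c k * V i k) +
        2 * (c j * ∑ k ∈ (Finset.univ.erase i).erase j, c k * V j k) +
        ∑ k ∈ (Finset.univ.erase i).erase j,
          ∑ l ∈ ((Finset.univ.erase i).erase j).erase k, c k * c l * V k l := by
  rw [mergeRed_sum_univ_split hij, mergeRed_sum_erase_left hij, mergeRed_sum_erase_right hij]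
  have hrest : ∑ k ∈ (Finset.univ.erase i).erase j, ∑ l ∈ Finset.univ.erase k, c k * c l * V k l =
      ∑ k ∈ (Finset.univ.erase i).erase j, (c i * (c k * V i k) + c j * (c k * V j k) +
        ∑ l ∈ ((Finset.univ.erase i).erase j).erase k, c k * c l * V k l) := by
    refine Finset.sum_congr rfl fun k hk => ?_
    rw [mergeRed_sum_erase_of_mem_rest hij hk, hV k i, hV k j]
    ring
  have h1 : ∑ l ∈ (Finset.univ.erase i).erase j, c i * c l * V i l =
      c i * ∑ k ∈ (Finset.univ.erase i).erase j, c k * V i k := by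
    rw [Finset.mul_sum]
    exact Finset.sum_congr rfl fun k _ => by ring
  have h2 : ∑ l ∈ (Finset.univ.erase i).erase j, c j * c l * V j l =
      c j * ∑ k ∈ (Finset.univ.erase i).erase j, c k * V j k := by
    rw [Finset.mul_sum]
    exact Finset.sum_congr rfl fun k _ => by ring
  rw [hrest, Finset.sum_add_distrib, Finset.sum_add_distrib, ← Finset.mul_sum, ← Finset.mul_sum,
    h1, h2, hV j i]
  ring

/-- THE MERGE STEP.  For `i ≠ j` with `−2E ≤ V i j`, non-negative weights and `Lᵢ ≤ Lⱼ`, moving the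
weight of `j` onto `i` does not increase `F = (quadratic form) − 2E·∑ c²`:
`F(c) − F(c') = 2cᵢcⱼ(V i j + 2E) + 2cⱼ(Lⱼ − Lᵢ) ≥ 0`. [folklore] -/
private theorem mergeRed_merge_le (V : ι → ι → ℝ) (hV : ∀ k l, V k l = V l k) (E : ℝ)
    (c c' : ι → ℝ) (hc : ∀ k, 0 ≤ c k) {i j : ι} (hij : i ≠ j) (hVij : -2 * E ≤ V i j)
    (hL : ∑ k ∈ (Finset.univ.erase i).erase j, c k * V i k ≤
      ∑ k ∈ (Finset.univ.erase i).erase j, c k * V j k)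
    (hi : c' i = c i + c j) (hj : c' j = 0) (hk : ∀ k, k ≠ i → k ≠ j → c' k = c k) :
    (∑ k, ∑ l ∈ Finset.univ.erase k, c' k * c' l * V k l) - 2 * E * ∑ k, c' k ^ 2 ≤
      (∑ k, ∑ l ∈ Finset.univ.erase k, c k * c l * V k l) - 2 * E * ∑ k, c k ^ 2 := by
  have hR : ∀ k ∈ (Finset.univ.erase i).erase j, c' k = c k := fun k hkR => by
    simp only [Finset.mem_erase, Finset.mem_univ, and_true] at hkR
    exact hk k hkR.2 hkR.1
  have e1 : ∑ k ∈ (Finset.univ.erase i).erase j, c' k * V i k =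
      ∑ k ∈ (Finset.univ.erase i).erase j, c k * V i k :=
    Finset.sum_congr rfl fun k hk => by rw [hR k hk]
  have e2 : ∑ k ∈ (Finset.univ.erase i).erase j, c' k * V j k =
      ∑ k ∈ (Finset.univ.erase i).erase j, c k * V j k :=
    Finset.sum_congr rfl fun k hk => by rw [hR k hk]
  have e3 : ∑ k ∈ (Finset.univ.erase i).erase j,
        ∑ l ∈ ((Finset.univ.erase i).erase j).erase k, c' k * c' l * V k l =
      ∑ k ∈ (Finset.univ.erase i).erase j,
        ∑ l ∈ ((Finset.univ.erase i).erase j).erase k, c k * c l * V k l :=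
    Finset.sum_congr rfl fun k hk => Finset.sum_congr rfl fun l hl => by
      rw [hR k hk, hR l (Finset.mem_of_mem_erase hl)]
  have e4 : ∑ k ∈ (Finset.univ.erase i).erase j, c' k ^ 2 =
      ∑ k ∈ (Finset.univ.erase i).erase j, c k ^ 2 :=
    Finset.sum_congr rfl fun k hk => by rw [hR k hk]
  rw [mergeRed_quad_decomp V hV c hij, mergeRed_quad_decomp V hV c' hij,
    mergeRed_sum_univ_split hij (fun k => c k ^ 2), mergeRed_sum_univ_split hij (fun k => c' k ^ 2),
    e1, e2, e3, e4, hi, hj]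
  have h1 : 0 ≤ c i * c j * (V i j + 2 * E) :=
    mul_nonneg (mul_nonneg (hc i) (hc j)) (by linarith)
  have h2 : 0 ≤ c j * (∑ k ∈ (Finset.univ.erase i).erase j, c k * V j k -
      ∑ k ∈ (Finset.univ.erase i).erase j, c k * V i k) :=
    mul_nonneg (hc j) (sub_nonneg.2 hL)
  nlinarith [h1, h2]

/-- PHASE A (weights only, positions fixed).  If `−2E ≤ V i j` for every CLOSE pair `i ≠ j`, then
every `c ≥ 0` can be replaced by some `c' ≥ 0` on the same index set whose support contains no
close pair and with `F(c') ≤ F(c)`; induction on the size of the support, one merge per step.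
[folklore] -/
private theorem mergeRed_phaseA (V : ι → ι → ℝ) (hV : ∀ k l, V k l = V l k) (E : ℝ)
    (close : ι → ι → Prop) (hcl : ∀ i j, i ≠ j → close i j → -2 * E ≤ V i j) :
    ∀ (n : ℕ) (c : ι → ℝ), (Finset.univ.filter fun i => c i ≠ 0).card ≤ n → (∀ i, 0 ≤ c i) →
      ∃ c' : ι → ℝ, (∀ i, 0 ≤ c' i) ∧ (∀ i j, i ≠ j → c' i ≠ 0 → c' j ≠ 0 → ¬ close i j) ∧
        (∑ k, ∑ l ∈ Finset.univ.erase k, c' k * c' l * V k l) - 2 * E * ∑ k, c' k ^ 2 ≤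
          (∑ k, ∑ l ∈ Finset.univ.erase k, c k * c l * V k l) - 2 * E * ∑ k, c k ^ 2 := by
  intro n
  induction n with
  | zero =>
    intro c hcard hc
    refine ⟨c, hc, fun i j _ hi _ _ => ?_, le_rfl⟩
    have hmem : i ∈ Finset.univ.filter fun i => c i ≠ 0 := by simp [hi]
    have hpos := Finset.card_pos.2 ⟨i, hmem⟩
    omega
  | succ n ih =>
    intro c hcard hc
    by_cases hex : ∃ i j, i ≠ j ∧ c i ≠ 0 ∧ c j ≠ 0 ∧ close i j
    · obtain ⟨i₀, j₀, hne, hi₀, hj₀, hcl₀⟩ := hex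
      have key : ∀ i j, i ≠ j → c i ≠ 0 → c j ≠ 0 → -2 * E ≤ V i j →
          (∑ k ∈ (Finset.univ.erase i).erase j, c k * V i k ≤
            ∑ k ∈ (Finset.univ.erase i).erase j, c k * V j k) →
          ∃ c' : ι → ℝ, (∀ i, 0 ≤ c' i) ∧ (∀ i j, i ≠ j → c' i ≠ 0 → c' j ≠ 0 → ¬ close i j) ∧
            (∑ k, ∑ l ∈ Finset.univ.erase k, c' k * c' l * V k l) - 2 * E * ∑ k, c' k ^ 2 ≤
              (∑ k, ∑ l ∈ Finset.univ.erase k, c k * c l * V k l) - 2 * E * ∑ k, c k ^ 2 := by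
        intro i j hij hi _ hVij hL
        obtain ⟨c'', hi', hj', hk'⟩ : ∃ c'' : ι → ℝ, c'' i = c i + c j ∧ c'' j = 0 ∧
            ∀ k, k ≠ i → k ≠ j → c'' k = c k :=
          ⟨fun k => if k = i then c i + c j else if k = j then 0 else c k, by simp,
            by simp [hij.symm], fun k hki hkj => by simp [hki, hkj]⟩
        have hc'' : ∀ k, 0 ≤ c'' k := by
          intro k
          by_cases hki : k = i
          · rw [hki, hi']
            exact add_nonneg (hc i) (hc j)
          by_cases hkj : k = j
          · rw [hkj, hj']
          rw [hk' k hki hkj]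
          exact hc k
        have hcard'' : (Finset.univ.filter fun k => c'' k ≠ 0).card ≤ n := by
          have hsub : (Finset.univ.filter fun k => c'' k ≠ 0) ⊆
              (Finset.univ.filter fun k => c k ≠ 0).erase j := by
            intro k hk
            simp only [Finset.mem_filter, Finset.mem_univ, true_and, Finset.mem_erase] at hk ⊢
            have hkj : k ≠ j := fun hkj => hk (by rw [hkj, hj'])
            refine ⟨hkj, ?_⟩
            by_cases hki : k = i
            · rw [hki]
              exact hi
            rwa [hk' k hki hkj] at hk
          have hle := Finset.card_le_card hsub
          have hjmem : j ∈ Finset.univ.filter fun k => c k ≠ 0 := by simpa using ‹c j ≠ 0›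
          rw [Finset.card_erase_of_mem hjmem] at hle
          omega
        obtain ⟨c', hc', hsep', hF'⟩ := ih c'' hcard'' hc''
        exact ⟨c', hc', hsep', hF'.trans (mergeRed_merge_le V hV E c c'' hc hij hVij hL hi' hj' hk')⟩
      rcases le_total (∑ k ∈ (Finset.univ.erase i₀).erase j₀, c k * V i₀ k)
          (∑ k ∈ (Finset.univ.erase i₀).erase j₀, c k * V j₀ k) with hL | hL
      · exact key i₀ j₀ hne hi₀ hj₀ (hcl _ _ hne hcl₀) hL
      · refine key j₀ i₀ hne.symm hj₀ hi₀ (by rw [hV]; exact hcl _ _ hne hcl₀) ?_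
        rw [Finset.erase_right_comm (a := j₀) (b := i₀)]
        exact hL
    · push Not at hex
      exact ⟨c, hc, fun i j hij hi hj hcl' => hex i j hij hi hj hcl', le_rfl⟩

end MergeAlgebra

/-- PHASE B (re-indexing).  Weights `c ≥ 0` on `Fin N` whose support is `δ`-separated give, after
restricting positions and weights to the support (enumerated increasingly), an honestly
`δ`-separated injective configuration with literally the same value of `F`. [folklore] -/
private theorem mergeRed_reindex {N : ℕ} (x : Fin N → EuclideanSpace ℝ (Fin 3))
    (hx : Function.Injective x) (δ E : ℝ) (c : Fin N → ℝ) (hc : ∀ i, 0 ≤ c i)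
    (hsep : ∀ i j, i ≠ j → c i ≠ 0 → c j ≠ 0 → δ ≤ dist (x i) (x j)) :
    ∃ (N' : ℕ) (x' : Fin N' → EuclideanSpace ℝ (Fin 3)) (c' : Fin N' → ℝ),
      Function.Injective x' ∧ (∀ i j, i ≠ j → δ ≤ dist (x' i) (x' j)) ∧ (∀ i, 0 ≤ c' i) ∧
      (∑ i, ∑ j ∈ Finset.univ.erase i, c' i * c' j * lennardJones (dist (x' i) (x' j))) -
          2 * E * ∑ i, c' i ^ 2 =
        (∑ i, ∑ j ∈ Finset.univ.erase i, c i * c j * lennardJones (dist (x i) (x j))) -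
          2 * E * ∑ i, c i ^ 2 := by
  obtain ⟨s, hs⟩ : ∃ s : Finset (Fin N), ∀ i, i ∈ s ↔ c i ≠ 0 :=
    ⟨Finset.univ.filter fun i => c i ≠ 0, fun i => by simp⟩
  obtain ⟨N', e, hmap⟩ : ∃ (N' : ℕ) (e : Fin N' ↪ Fin N), Finset.univ.map e = s :=
    ⟨s.card, (s.orderEmbOfFin rfl).toEmbedding, Finset.map_orderEmbOfFin_univ s rfl⟩
  have hmem : ∀ i', c (e i') ≠ 0 := fun i' => by
    have h := Finset.mem_map_of_mem e (Finset.mem_univ i')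
    rw [hmap] at h
    exact (hs _).1 h
  have hzero : ∀ i, i ∉ s → c i = 0 := fun i hi => not_not.1 (mt (hs i).2 hi)
  refine ⟨N', x ∘ e, c ∘ e, hx.comp e.injective,
    fun i' j' hij => hsep _ _ (e.injective.ne hij) (hmem i') (hmem j'), fun i' => hc _, ?_⟩
  have hquad : ∑ i', ∑ j' ∈ Finset.univ.erase i',
      (c ∘ e) i' * (c ∘ e) j' * lennardJones (dist ((x ∘ e) i') ((x ∘ e) j')) =
      ∑ i, ∑ j ∈ Finset.univ.erase i, c i * c j * lennardJones (dist (x i) (x j)) := by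
    calc ∑ i', ∑ j' ∈ Finset.univ.erase i',
          (c ∘ e) i' * (c ∘ e) j' * lennardJones (dist ((x ∘ e) i') ((x ∘ e) j'))
        = ∑ i', ∑ j ∈ Finset.univ.erase (e i'),
            c (e i') * c j * lennardJones (dist (x (e i')) (x j)) := by
          refine Finset.sum_congr rfl fun i' _ => ?_
          calc ∑ j' ∈ Finset.univ.erase i',
                (c ∘ e) i' * (c ∘ e) j' * lennardJones (dist ((x ∘ e) i') ((x ∘ e) j'))
              = ∑ j ∈ (Finset.univ.erase i').map e,
                  c (e i') * c j * lennardJones (dist (x (e i')) (x j)) :=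
                (Finset.sum_map (Finset.univ.erase i') e
                  (fun j => c (e i') * c j * lennardJones (dist (x (e i')) (x j)))).symm
            _ = ∑ j ∈ s.erase (e i'), c (e i') * c j * lennardJones (dist (x (e i')) (x j)) := by
                rw [Finset.map_erase, hmap]
            _ = ∑ j ∈ Finset.univ.erase (e i'),
                  c (e i') * c j * lennardJones (dist (x (e i')) (x j)) := by
                refine Finset.sum_subset (Finset.erase_subset_erase _ (Finset.subset_univ s)) ?_
                intro j hj hjs
                have hjs' : j ∉ s := fun h =>
                  hjs (Finset.mem_erase.2 ⟨(Finset.mem_erase.1 hj).1, h⟩)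
                rw [hzero j hjs']
                ring
      _ = ∑ i ∈ s, ∑ j ∈ Finset.univ.erase i, c i * c j * lennardJones (dist (x i) (x j)) := by
          rw [← hmap, Finset.sum_map]
      _ = ∑ i, ∑ j ∈ Finset.univ.erase i, c i * c j * lennardJones (dist (x i) (x j)) := by
          refine Finset.sum_subset (Finset.subset_univ s) fun i _ his => ?_
          rw [hzero i his]
          exact Finset.sum_eq_zero fun j _ => by ring
  have hsq : ∑ i', (c ∘ e) i' ^ 2 = ∑ i, c i ^ 2 := by
    calc ∑ i', (c ∘ e) i' ^ 2 = ∑ i ∈ s, c i ^ 2 := by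
          rw [← hmap, Finset.sum_map]
          rfl
      _ = ∑ i, c i ^ 2 := by
          refine Finset.sum_subset (Finset.subset_univ s) fun i _ his => ?_
          rw [hzero i his]
          ring
  rw [hquad, hsq]

/-- **Stub `stub_mergeReduction` (line `merge-perron`, crux `NoFractionalGain`,
stmt-AtomisticToContinuum-15098) — the weighted no-splitting (merge) reduction.**  If the core of
the Lennard-Jones potential is at least `−2E*` high on `(0, δ]` (`E* = ⨅_Q e_LJ(Q)`), then for
every weighted configuration `(x, c ≥ 0)` of distinct points of `ℝ³` there is a `δ`-SEPARATED
weighted configuration `(x', c' ≥ 0)` whose defect functional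
`F = ∑_{i ≠ j} cᵢcⱼV_LJ(|xᵢ − xⱼ|) − 2E*·∑ cᵢ²` is not larger.  Obtained by repeatedly deleting one
point of a close pair and adding its weight to the partner with the smaller external field
(`mergeRed_phaseA`, key identity `F(pair) − F(merged) = 2c₂(L₂ − L₁) + 2c₁c₂(V₁₂ + 2E*)`), then
re-indexing the support (`mergeRed_reindex`). [folklore] -/
theorem stub_mergeReduction : ∀ δ : ℝ, 0 < δ →
    (∀ r : ℝ, 0 < r → r ≤ δ →
      -2 * (⨅ Q : PeriodicConfiguration 3, Q.energyPerParticle lennardJones) ≤ lennardJones r) →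
    ∀ (N : ℕ) (x : Fin N → EuclideanSpace ℝ (Fin 3)), Function.Injective x →
    ∀ c : Fin N → ℝ, (∀ i, 0 ≤ c i) →
    ∃ (N' : ℕ) (x' : Fin N' → EuclideanSpace ℝ (Fin 3)) (c' : Fin N' → ℝ),
      Function.Injective x' ∧ (∀ i j, i ≠ j → δ ≤ dist (x' i) (x' j)) ∧ (∀ i, 0 ≤ c' i) ∧
      (∑ i, ∑ j ∈ Finset.univ.erase i, c' i * c' j * lennardJones (dist (x' i) (x' j))) -
          2 * (⨅ Q : PeriodicConfiguration 3, Q.energyPerParticle lennardJones) * ∑ i, c' i ^ 2 ≤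
        (∑ i, ∑ j ∈ Finset.univ.erase i, c i * c j * lennardJones (dist (x i) (x j))) -
          2 * (⨅ Q : PeriodicConfiguration 3, Q.energyPerParticle lennardJones) * ∑ i, c i ^ 2 := by
  intro δ _ hcore N x hx c hc
  set E : ℝ := ⨅ Q : PeriodicConfiguration 3, Q.energyPerParticle lennardJones with hE
  obtain ⟨c₁, hc₁, hsep₁, hF₁⟩ := mergeRed_phaseA (fun k l => lennardJones (dist (x k) (x l)))
    (fun k l => by simp only [dist_comm]) E (fun k l => dist (x k) (x l) < δ)
    (fun i j hij hlt => hcore _ (dist_pos.2 (hx.ne hij)) (le_of_lt hlt))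
    _ c le_rfl hc
  have hsep₁' : ∀ i j, i ≠ j → c₁ i ≠ 0 → c₁ j ≠ 0 → δ ≤ dist (x i) (x j) :=
    fun i j hij hi hj => not_lt.1 (hsep₁ i j hij hi hj)
  obtain ⟨N', x', c', hx', hsep', hc', hF'⟩ := mergeRed_reindex x hx δ E c₁ hc₁ hsep₁'
  exact ⟨N', x', c', hx', hsep', hc', hF'.trans_le hF₁⟩

/-- **The merge reduction with an ARBITRARY level `E`** (same proof as `stub_mergeReduction`, whose
level is `E* = ⨅_Q e_LJ(Q)`).  If `−2E ≤ V_LJ(r)` for `0 < r ≤ δ`, then every weighted configuration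
`(x, c ≥ 0)` of distinct points of `ℝ³` admits a `δ`-separated weighted configuration `(x', c' ≥ 0)` with
`∑_{i≠j} c'ᵢc'ⱼV_LJ(|x'ᵢ − x'ⱼ|) − 2E·∑ c'ᵢ² ≤ ∑_{i≠j} cᵢcⱼV_LJ(|xᵢ − xⱼ|) − 2E·∑ cᵢ²`.  Used with
`E = e_LJ(hcp a h)` (line `merge-perron`, heart-size theorem: an explicit-constant copositive bound on
`δ`-separated sets extends to all finite configurations). [folklore] -/
theorem mergeReduction_of_coreHeight : ∀ (E δ : ℝ),
    (∀ r : ℝ, 0 < r → r ≤ δ → -2 * E ≤ lennardJones r) →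
    ∀ {N : ℕ} (x : Fin N → EuclideanSpace ℝ (Fin 3)), Function.Injective x →
    ∀ (c : Fin N → ℝ), (∀ i, 0 ≤ c i) →
    ∃ (N' : ℕ) (x' : Fin N' → EuclideanSpace ℝ (Fin 3)) (c' : Fin N' → ℝ),
      Function.Injective x' ∧ (∀ i j, i ≠ j → δ ≤ dist (x' i) (x' j)) ∧ (∀ i, 0 ≤ c' i) ∧
      (∑ i, ∑ j ∈ Finset.univ.erase i, c' i * c' j * lennardJones (dist (x' i) (x' j))) -
          2 * E * ∑ i, c' i ^ 2 ≤
        (∑ i, ∑ j ∈ Finset.univ.erase i, c i * c j * lennardJones (dist (x i) (x j))) -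
          2 * E * ∑ i, c i ^ 2 := by
  intro E δ hcore N x hx c hc
  obtain ⟨c₁, hc₁, hsep₁, hF₁⟩ := mergeRed_phaseA (fun k l => lennardJones (dist (x k) (x l)))
    (fun k l => by simp only [dist_comm]) E (fun k l => dist (x k) (x l) < δ)
    (fun i j hij hlt => hcore _ (dist_pos.2 (hx.ne hij)) (le_of_lt hlt))
    _ c le_rfl hc
  have hsep₁' : ∀ i j, i ≠ j → c₁ i ≠ 0 → c₁ j ≠ 0 → δ ≤ dist (x i) (x j) :=
    fun i j hij hi hj => not_lt.1 (hsep₁ i j hij hi hj)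
  obtain ⟨N', x', c', hx', hsep', hc', hF'⟩ := mergeRed_reindex x hx δ E c₁ hc₁ hsep₁'
  exact ⟨N', x', c', hx', hsep', hc', hF'.trans_le hF₁⟩

end Summit.AtomisticToContinuum.Crystallization.Theorems.PerronTransitivity.NoFractionalGain

end
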